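import Mathlib
import HarnessLib

/-!
# Route `KLProgramme` — crux C4a, (U1): THE FAR LEVELS `hi ≤ |e|` OF THE FIRST-ORDER ϑ-LAYER ARE AN ENVELOPE TERM (no geometry, no cancellation)

Cell `gate-hubbard-kl`, seat hubbard-kl-k3c3-p3 (g35; row «implicit-function / monotonicity route for μ(n)»).  Helper for stub (C) `stub_twoLeg_curvature` of
`KLRegimeEngineV17F2` (stmt-HubbardSuperconductivity-20437); item «levels `|e| > hi₀` by envelopes» of the pen's (R383) LEFT-FOR-THE-CLOSER list; memo
HOME/hubbard-kl-k3c3-p3/U1-CAUSTIC-SUP.md §18.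

WHY.  The (U1) arc theorems (`loopCircle_twoArcs_integral_le[_canonical][_mf|_perturbative]`) integrate the loop level over `[−hi, hi]`, `hi ≤ hi₀` threshold-small, where the
kernel `(K e)′` is singular at scale `max(|e|, |u|)`.  On the complementary levels `hi ≤ |e| ≤ E` the first-order envelope `|(K e)′(u)| ≤ max(|e|,|u|)⁻²` is already
`≤ hi⁻²`, so the layer is bounded by brute force, uniformly in the relative angle and with NO hypothesis on the partner band `ē` (an arbitrary real function here):
* **`farLevels_integral_le`**: `∫_α^β |∫_a^b ∫_{φa}^{φb} w(e)·Y(e,v)·(K e)′(ē(e,v,ϑ)) dv de| dϑ ≤ (β−α)(b−a)(φb−φa)·W·Y₀/hi²` for any level window `[a,b]` with `hi ≤ |e|` on it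
  (`|w| ≤ W`, `|Y| ≤ Y₀`, the envelope row on `[a,b]`); no integrability is needed (`intervalIntegral.norm_integral_le_of_norm_le_const` three times).
Elementary; nothing asserts (C), K3, the window or superconductivity.
References: FST II CPAM 51 (1998) §3 [cite: FeldmanSalmhoferTrubowitz1998]; BGM 2006 §2.4 [cite: BenfattoGiulianiMastropietro2006].
-/

noncomputable section

namespace Summit.HubbardSuperconductivity.HubbardSuperconductivity.Theorems.C4a

set_option linter.dupNamespace false -- summit = problem name (single-conjunct summit), D-0017

open Real Set MeasureTheory intervalIntegral

/-- **THE FAR LEVELS ARE AN ENVELOPE TERM**: on a level window `[a, b]` with `hi ≤ |e|` (`0 < hi`), the kernel row `|(K e)′(u)| ≤ max(|e|,|u|)⁻²`, `|w| ≤ W`, `|Y| ≤ Y₀`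
give `∫_α^β |∫_a^b ∫_{φa}^{φb} w(e)·(Y(e,v)·(K e)′(ē(e,v,ϑ))) dv de| dϑ ≤ (β − α)·((b − a)·((φb − φa)·(W·Y₀/hi²)))` for ANY function `ē` (no geometry of the partner band). -/
theorem farLevels_integral_le {α β a b φa φb hi W Y₀ : ℝ} (hαβ : α ≤ β) (hab : a ≤ b) (hφ : φa ≤ φb) (hhi : 0 < hi) (hW : 0 ≤ W) (hY₀ : 0 ≤ Y₀)
    {Kr Y : ℝ → ℝ → ℝ} {wt : ℝ → ℝ} {eb : ℝ → ℝ → ℝ → ℝ}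
    (hfar : ∀ e ∈ Icc a b, hi ≤ |e|) (hK1 : ∀ e ∈ Icc a b, ∀ u, |deriv (Kr e) u| ≤ (max |e| |u|)⁻¹ ^ 2)
    (hw : ∀ e ∈ Icc a b, |wt e| ≤ W) (hY : ∀ e ∈ Icc a b, ∀ v, |Y e v| ≤ Y₀) :
    ∫ ϑ in α..β, |∫ e in a..b, ∫ v in φa..φb, wt e * (Y e v * deriv (Kr e) (eb e v ϑ))| ≤
      (β - α) * ((b - a) * ((φb - φa) * (W * Y₀ / hi ^ 2))) := by
  -- pointwise envelope on the far levels
  have hpt : ∀ e ∈ Icc a b, ∀ v ϑ, |wt e * (Y e v * deriv (Kr e) (eb e v ϑ))| ≤ W * Y₀ / hi ^ 2 := by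
    intro e he v ϑ
    have h1 := hK1 e he (eb e v ϑ)
    have hmax : hi ≤ max |e| |eb e v ϑ| := (hfar e he).trans (le_max_left _ _)
    have hmpos : 0 < max |e| |eb e v ϑ| := hhi.trans_le hmax
    have h2 : (max |e| |eb e v ϑ|)⁻¹ ^ 2 ≤ hi⁻¹ ^ 2 :=
      pow_le_pow_left₀ (inv_nonneg.2 hmpos.le) ((inv_le_inv₀ hmpos hhi).2 hmax) 2
    have hK : |deriv (Kr e) (eb e v ϑ)| ≤ 1 / hi ^ 2 := by
      have e1 : hi⁻¹ ^ 2 = 1 / hi ^ 2 := by rw [inv_pow, one_div]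
      linarith [h1, h2, e1.le, e1.ge]
    rw [abs_mul, abs_mul]
    have hwY : |wt e| * |Y e v| ≤ W * Y₀ := mul_le_mul (hw e he) (hY e he v) (abs_nonneg _) hW
    calc |wt e| * (|Y e v| * |deriv (Kr e) (eb e v ϑ)|) = |wt e| * |Y e v| * |deriv (Kr e) (eb e v ϑ)| := by ring
      _ ≤ W * Y₀ * (1 / hi ^ 2) := mul_le_mul hwY hK (abs_nonneg _) (mul_nonneg hW hY₀)
      _ = W * Y₀ / hi ^ 2 := by ring
  -- the loop-angle integral
  have hv : ∀ e ∈ Icc a b, ∀ ϑ, |∫ v in φa..φb, wt e * (Y e v * deriv (Kr e) (eb e v ϑ))| ≤ W * Y₀ / hi ^ 2 * (φb - φa) := by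
    intro e he ϑ
    have h := intervalIntegral.norm_integral_le_of_norm_le_const (a := φa) (b := φb) (C := W * Y₀ / hi ^ 2)
      (f := fun v => wt e * (Y e v * deriv (Kr e) (eb e v ϑ))) (fun v _ => by rw [Real.norm_eq_abs]; exact hpt e he v ϑ)
    rw [Real.norm_eq_abs, abs_of_nonneg (sub_nonneg.2 hφ)] at h
    exact h
  -- the level integral
  have he : ∀ ϑ, |∫ e in a..b, ∫ v in φa..φb, wt e * (Y e v * deriv (Kr e) (eb e v ϑ))| ≤ W * Y₀ / hi ^ 2 * (φb - φa) * (b - a) := by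
    intro ϑ
    have h := intervalIntegral.norm_integral_le_of_norm_le_const (a := a) (b := b) (C := W * Y₀ / hi ^ 2 * (φb - φa))
      (f := fun e => ∫ v in φa..φb, wt e * (Y e v * deriv (Kr e) (eb e v ϑ))) (fun e he' => by
        rw [Real.norm_eq_abs]
        have heI : e ∈ Icc a b := by rw [uIoc_of_le hab] at he'; exact Ioc_subset_Icc_self he'
        exact hv e heI ϑ)
    rw [Real.norm_eq_abs, abs_of_nonneg (sub_nonneg.2 hab)] at h
    exact h
  -- the relative-angle integral
  have hϑ := intervalIntegral.norm_integral_le_of_norm_le_const (a := α) (b := β) (C := W * Y₀ / hi ^ 2 * (φb - φa) * (b - a))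
    (f := fun ϑ => |∫ e in a..b, ∫ v in φa..φb, wt e * (Y e v * deriv (Kr e) (eb e v ϑ))|) (fun ϑ _ => by
      rw [Real.norm_eq_abs, abs_abs]; exact he ϑ)
  rw [Real.norm_eq_abs, abs_of_nonneg (sub_nonneg.2 hαβ)] at hϑ
  have hnn : 0 ≤ ∫ ϑ in α..β, |∫ e in a..b, ∫ v in φa..φb, wt e * (Y e v * deriv (Kr e) (eb e v ϑ))| :=
    intervalIntegral.integral_nonneg hαβ fun ϑ _ => abs_nonneg _
  calc ∫ ϑ in α..β, |∫ e in a..b, ∫ v in φa..φb, wt e * (Y e v * deriv (Kr e) (eb e v ϑ))|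
      ≤ abs (∫ ϑ in α..β, |∫ e in a..b, ∫ v in φa..φb, wt e * (Y e v * deriv (Kr e) (eb e v ϑ))|) := le_abs_self _
    _ ≤ W * Y₀ / hi ^ 2 * (φb - φa) * (b - a) * (β - α) := hϑ
    _ = (β - α) * ((b - a) * ((φb - φa) * (W * Y₀ / hi ^ 2))) := by ring

end Summit.HubbardSuperconductivity.HubbardSuperconductivity.Theorems.C4a

end
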